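import Mathlib
import Summits.Ventures.PercRepro2.V2ParallelClosure
import Summits.Ventures.PercRepro2.V2SP

/-!
# The Hall (monotone-relay) form of the off-axis family: the framework (seat mine-b, cell pub-perc-repro2; MINE-B.md §36)

For a labelled preorder `(X, r, b)` and a label weight `h : ℕ → ℕ → ℤ`, `HallFn h r b` says that every
upper set of `X` carries non-negative `h`-mass.  The off-axis weight is

  `phi a j r b = [r + 1 = a ∧ j + 1 ≤ b] − [a ≤ r ∧ b = j]`,

so `HallFn (phi a j)` on the configuration poset (red < blue) is, by Hall's theorem, the existence of an
injection from `{r ≥ a, b = j}` into `{r = a−1, b ≥ j+1}` that only recolours red edges blue — the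
monotone relay behind `T(a,j) ≤ T(a−1,j+1)` (the upper set `univ` gives the count).

Two generic facts make such conditions inductive (the fibre method of `V2ParallelClosure.lean`): on an
upper set `W ⊆ X × Y` a product `h(x)·β(y)` with `h` Hall on `X` and `β ≥ 0` has non-negative sum
(`sum_hall_mul_nonneg_fst`, fibres over `y`), and symmetrically (`sum_mul_hall_nonneg_snd`).  The series
step of `phi a j` is the pointwise identity

  `phi a j (min r r') (min b b') = [a−1 ≤ r' ∧ j+1 ≤ b']·phi a j r b + [a ≤ r ∧ j ≤ b]·phi a j r' b'`

(`phi_ser_eq`), whence `hallFn_phi_ser`.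
-/

namespace Summit.Ventures.PercRepro2.V2Closure

open Finset

variable {X Y : Type*}

/-- `h` is Hall on the labelled preorder `(X, r, b)`: every upper set has non-negative `h`-mass. -/
def HallFn [Preorder X] (h : ℕ → ℕ → ℤ) (r b : X → ℕ) : Prop :=
  ∀ V : Finset X, IsUpperSet (↑V : Set X) → 0 ≤ ∑ x ∈ V, h (r x) (b x)

/-- The off-axis weight `phi a j r b = [r + 1 = a ∧ j + 1 ≤ b] − [a ≤ r ∧ b = j]`. -/
def phi (a j : ℕ) (r b : ℕ) : ℤ :=
  (if r + 1 = a ∧ j + 1 ≤ b then 1 else 0) - (if a ≤ r ∧ b = j then 1 else 0)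

/-- The upper set `univ` of a Hall weight: the count is non-negative. -/
theorem HallFn.sum_univ_nonneg [Preorder X] [Fintype X] {h : ℕ → ℕ → ℤ} {r b : X → ℕ} (hX : HallFn h r b) :
    0 ≤ ∑ x, h (r x) (b x) :=
  hX univ (by simp [isUpperSet_univ])

/-- A non-negative weight is Hall. -/
theorem hallFn_of_nonneg [Preorder X] {h : ℕ → ℕ → ℤ} (hh : ∀ u v, 0 ≤ h u v) (r b : X → ℕ) : HallFn h r b :=
  fun _ _ => Finset.sum_nonneg (fun _ _ => hh _ _)

/-- Hall weights add. -/
theorem HallFn.add [Preorder X] {h h' : ℕ → ℕ → ℤ} {r b : X → ℕ} (hX : HallFn h r b) (hX' : HallFn h' r b) :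
    HallFn (fun u v => h u v + h' u v) r b := by
  intro V hV
  rw [Finset.sum_add_distrib]
  exact add_nonneg (hX V hV) (hX' V hV)

/-- Hall weights are stable under pointwise domination. -/
theorem HallFn.mono [Preorder X] {h h' : ℕ → ℕ → ℤ} {r b : X → ℕ} (hX : HallFn h r b)
    (hle : ∀ u v, h u v ≤ h' u v) : HallFn h' r b := by
  intro V hV
  exact le_trans (hX V hV) (Finset.sum_le_sum (fun x _ => hle _ _))

/-- A Hall weight of `X` times a non-negative weight of `Y`: non-negative mass on every upper set of
`X × Y` (fibres over `y` are upper sets of `X`). -/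
theorem sum_hall_mul_nonneg_fst [Preorder X] [Preorder Y] [Fintype X] [Fintype Y] [DecidableEq X] [DecidableEq Y]
    {h : ℕ → ℕ → ℤ} {r b : X → ℕ} (hX : HallFn h r b) (r' b' : Y → ℕ) (β : ℕ → ℕ → ℤ) (hβ : ∀ u v, 0 ≤ β u v)
    (W : Finset (X × Y)) (hW : IsUpperSet (↑W : Set (X × Y))) :
    0 ≤ ∑ p ∈ W, h (r p.1) (b p.1) * β (r' p.2) (b' p.2) := by
  rw [sum_W_eq W (fun x => h (r x) (b x)) (fun y => β (r' y) (b' y)), Finset.sum_comm]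
  apply Finset.sum_nonneg
  intro y _
  have hfib := hX (univ.filter (fun x : X => (x, y) ∈ W)) (fibre_fst_isUpperSet W hW y)
  rw [Finset.sum_filter] at hfib
  have e : ∑ x, ind W x y * (h (r x) (b x) * β (r' y) (b' y))
      = (∑ x, (if (x, y) ∈ W then h (r x) (b x) else 0)) * β (r' y) (b' y) := by
    rw [Finset.sum_mul]
    apply Finset.sum_congr rfl
    intro x _
    unfold ind; split_ifs <;> simp
  rw [e]
  exact mul_nonneg hfib (hβ _ _)

/-- A non-negative weight of `X` times a Hall weight of `Y` (fibres over `x`). -/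
theorem sum_mul_hall_nonneg_snd [Preorder X] [Preorder Y] [Fintype X] [Fintype Y] [DecidableEq X] [DecidableEq Y]
    (r b : X → ℕ) {h : ℕ → ℕ → ℤ} {r' b' : Y → ℕ} (hY : HallFn h r' b') (α : ℕ → ℕ → ℤ) (hα : ∀ u v, 0 ≤ α u v)
    (W : Finset (X × Y)) (hW : IsUpperSet (↑W : Set (X × Y))) :
    0 ≤ ∑ p ∈ W, α (r p.1) (b p.1) * h (r' p.2) (b' p.2) := by
  rw [sum_W_eq W (fun x => α (r x) (b x)) (fun y => h (r' y) (b' y))]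
  apply Finset.sum_nonneg
  intro x _
  have hfib := hY (univ.filter (fun y : Y => (x, y) ∈ W)) (fibre_snd_isUpperSet W hW x)
  rw [Finset.sum_filter] at hfib
  have e : ∑ y, ind W x y * (α (r x) (b x) * h (r' y) (b' y))
      = α (r x) (b x) * ∑ y, (if (x, y) ∈ W then h (r' y) (b' y) else 0) := by
    rw [Finset.mul_sum]
    apply Finset.sum_congr rfl
    intro y _
    unfold ind; split_ifs <;> simp
  rw [e]
  exact mul_nonneg (hα _ _) hfib

/-- The series identity for the off-axis weight. -/
theorem phi_ser_eq (a j r b r' b' : ℕ) :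
    phi a j (min r r') (min b b')
      = (if a ≤ r' + 1 ∧ j + 1 ≤ b' then (1 : ℤ) else 0) * phi a j r b
        + (if a ≤ r ∧ j ≤ b then (1 : ℤ) else 0) * phi a j r' b' := by
  unfold phi
  rcases le_total r r' with h1 | h1 <;> rcases le_total b b' with h2 | h2 <;>
    simp only [min_eq_left h1, min_eq_right h1, min_eq_left h2, min_eq_right h2] <;>
    split_ifs <;> omega

/-- **The Hall form of `T(a,j) ≤ T(a−1,j+1)` is closed under series composition** (minima of the labels). -/
theorem hallFn_phi_ser [Preorder X] [Preorder Y] [Fintype X] [Fintype Y] [DecidableEq X] [DecidableEq Y]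
    (a j : ℕ) (r b : X → ℕ) (r' b' : Y → ℕ) (hX : HallFn (phi a j) r b) (hY : HallFn (phi a j) r' b') :
    HallFn (phi a j) (serR r r') (serB b b') := by
  intro W hW
  have e : ∑ p ∈ W, phi a j (serR r r' p) (serB b b' p)
      = ∑ p ∈ W, phi a j (r p.1) (b p.1) * (if a ≤ r' p.2 + 1 ∧ j + 1 ≤ b' p.2 then (1 : ℤ) else 0)
        + ∑ p ∈ W, (if a ≤ r p.1 ∧ j ≤ b p.1 then (1 : ℤ) else 0) * phi a j (r' p.2) (b' p.2) := by
    rw [← Finset.sum_add_distrib]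
    apply Finset.sum_congr rfl
    intro p _
    unfold serR serB
    rw [phi_ser_eq]; ring
  rw [e]
  apply add_nonneg
  · exact sum_hall_mul_nonneg_fst hX r' b' (fun u v => if a ≤ u + 1 ∧ j + 1 ≤ v then 1 else 0)
      (fun u v => by split_ifs <;> simp) W hW
  · exact sum_mul_hall_nonneg_snd r b hY (fun u v => if a ≤ u ∧ j ≤ v then 1 else 0)
      (fun u v => by split_ifs <;> simp) W hW

namespace Atoms

/-- `phi a j` on the two-state poset `Bool` (`false` = red, `true` = blue) with the free-edge labels:
Hall for every offset `a − j ≥ 1`. -/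
theorem hallFn_phi_free' (a j : ℕ) (h : j + 1 ≤ a) : HallFn (phi a j) freeR freeB := by
  intro V hV
  rw [sum_bool_eq]
  simp only [freeR, freeB, phi]
  by_cases hf : false ∈ V
  · have ht : true ∈ V := hV (show false ≤ true by decide) hf
    simp only [hf, ht, if_true]
    split_ifs <;> omega
  · simp only [hf, if_false, add_zero]
    split_ifs <;> omega

/-- `phi a j` on a free edge. -/
theorem hallFn_phi_free (a j : ℕ) (h : j + 1 ≤ a) : HallFn (phi a j) SP.free.rLab SP.free.bLab :=
  hallFn_phi_free' a j h

/-- `phi a j` on a pinned edge: the single state has flows `(1,1)`. -/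
theorem hallFn_phi_pin (a j : ℕ) (h : j + 1 ≤ a) : HallFn (phi a j) SP.pin.rLab SP.pin.bLab := by
  intro V _
  apply Finset.sum_nonneg
  intro c _
  show (0 : ℤ) ≤ phi a j 1 1
  unfold phi
  split_ifs <;> omega

/-- `phi a j` on an absent edge: the single state has flows `(0,0)`. -/
theorem hallFn_phi_absent (a j : ℕ) (h : j + 1 ≤ a) : HallFn (phi a j) SP.absent.rLab SP.absent.bLab := by
  intro V _
  apply Finset.sum_nonneg
  intro c _
  show (0 : ℤ) ≤ phi a j 0 0
  unfold phi
  split_ifs <;> omega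

end Atoms

end Summit.Ventures.PercRepro2.V2Closure
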